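import Mathlib.LinearAlgebra.TensorProduct.Tower
import Mathlib.LinearAlgebra.Dimension.Constructions
import Mathlib.LinearAlgebra.FiniteDimensional.Basic
import Mathlib.Algebra.BigOperators.Group.Finset.Basic
import Mathlib.Data.Int.Interval
import Literature.NumberTheory.GaloisRepresentations.PAdicHodgeBaseDatum
import HarnessLib

/-!
# Labelled Hodge–Tate weights `HT_τ(ρ)`

For a `p`-adic field `F`, a continuous representation `ρ` of `Γ = Γ_F` which is *linear over a
coefficient field* `E ⊇ ℚ_p` (a finite `E/ℚ_p`, or `E = ℚ̄_p = PadicAlgCl p`), a period-ring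
datum `𝔅 : PeriodRingData Γ P F` (`P` plays `ℚ_p`; intended `B_dR(F)` or `B_HT(F)`, file
`PAdicHodge`) and an embedding `τ : F →+* E`, this file defines the multiset
`𝔅.labelledHodgeTateWeights ρ τ : Multiset ℤ` of **`τ`-labelled Hodge–Tate weights**
`HT_τ(ρ)`: the jumps, with multiplicity, of the filtration induced by `Fil^• B` on the
`τ`-component of `D(ρ) = (V ⊗_{ℚ_p} B)^Γ`, a module over `F ⊗_{ℚ_p} E` (`F = B^Γ` acting through
`B`, `E` through `V`).  This is the formalism of Patrikis, *Variations on a theorem of Tate*,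
§2.3.1 ("Coefficients in Hodge theory": for a filtered `F ⊗_k E`-module `D`, `HT_τ(D)` is the
multiset of `h` with `gr^h (e_τ D) ≠ 0`, counted with dimension) and §2.7.1 ("labeled Hodge–Tate
weights": `HT_τ(V) := HT_τ(D_dR(V))` for `V` over `ℚ̄_ℓ`), and the notation `HT_τ` of
Barnet-Lamb–Gee–Geraghty–Taylor (Introduction, Notation: `HT_τ(W)` contains `i` with multiplicity
`dim_{ℚ̄_l} (W ⊗_{τ,K} K̂̄(i))^{G_K}`, so that `HT_τ(ε_l) = {-1}`).

## Main definitions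

* `Literature.NumberTheory.GaloisRepresentations.jumpMultiset d`: for `d : ℤ → ℕ` (think
  `d i = dim Fil^i`), the multiset containing `i` with multiplicity `d i - d (i + 1)`; junk value
  `0` if the set of jumps is infinite.  `PeriodRingData.hodgeTateWeights` is literally
  `jumpMultiset (dim Fil^• D)` (`PeriodRingData.hodgeTateWeights_eq_jumpMultiset`, `rfl`).
* `PeriodRingData.coeffTensorRep 𝔅 ρ`: the diagonal action of `Γ` on `M ⊗[P] 𝔅.B`, `E`-linear
  (coefficients on the LEFT factor, so that the `E`-module structure is Mathlib's
  `TensorProduct.leftModule`); `PeriodRingData.coeffD 𝔅 ρ = (M ⊗_P B)^Γ`, an `E`-submodule;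
  `PeriodRingData.baseAct 𝔅 E M f = id ⊗ (f • ·)`, the action of `f ∈ F` as an `E`-linear map;
  `PeriodRingData.coeffFilTensor 𝔅 E M i = M ⊗ Fil^i B`.
* `PeriodRingData.labelD 𝔅 ρ τ = {x ∈ (M ⊗ B)^Γ | ∀ f, (id ⊗ f) x = τ(f) • x}`, the
  **`τ`-component** `e_τ D` of `D`; `PeriodRingData.labelFilD 𝔅 ρ τ i = labelD ⊓ (M ⊗ Fil^i B)`.
* `PeriodRingData.labelledHodgeTateWeights 𝔅 ρ τ = jumpMultiset (dim_E Fil^• D_τ)` — **`HT_τ(ρ)`**;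
  `PeriodRingData.IsLabelledHodgeTateRegular 𝔅 ρ`: every `HT_τ(ρ)`, `τ : F →ₐ[P] E`, is
  multiplicity-free (Patrikis, Def. "regular" of §2.3.1; Barnet-Lamb–Gee–Geraghty–Taylor:
  "`n` distinct `τ`-Hodge–Tate numbers").
* `GaloisRep.labelledHodgeTateWeights` (alias for `Γ = Γ_F`) and the global wrapper
  `FramedGaloisRep.labelledHodgeTateWeightsAt ρ v alg 𝔅 τ` for `ρ : Γ_K →ₜ* GL_n(ℚ̄_ℓ)`, `K` a
  number field, `v` a finite place, `(alg, 𝔅)` the `ℚ_ℓ`-algebra structure and period-ring datum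
  of `K_v` (the fields `algebra`, `𝔅` of a `PstWeilDeligneData K_v ℓ`), and
  `τ : K_v →+* ℚ̄_ℓ`: `HT_τ(ρ|_{Γ_{K_v}})` computed `ℚ̄_ℓ`-linearly.
* `ContinuousRep.restrictScalars P ρ` and the bridge `PeriodRingData.comm_coeffTensorRep`,
  `PeriodRingData.mem_coeffD_iff`: `TensorProduct.comm` carries `coeffD 𝔅 ρ` onto the
  `D 𝔅 (ρ.restrictScalars P)` of `PAdicHodge`.

## Results

* `mem_jumpMultiset_iff`, `count_jumpMultiset`, `card_jumpMultiset` (telescoping: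
  `card = d a - d b` for an antitone `d` constant below `a` and above `b`), `jumpMultiset_step`
  (one jump); hence `PeriodRingData.card_labelledHodgeTateWeights`: if `Fil^a D_τ = D_τ` and
  `Fil^b D_τ = 0` then `card HT_τ(ρ) = dim_E D_τ`.
* `PeriodRingData.labelledHodgeTateWeights_trivial`: for the base datum `B = F`
  (`PeriodRingData.trivial`, trivial filtration jumping at `0`) every labelled weight is `0`:
  `HT_τ(ρ) = {0, …, 0}` (`dim_E D_τ` times); over the prime field (`F = P`, `τ = algebraMap`)
  and for `Γ` acting trivially on `M`, `D_τ` is all of `M ⊗_P P` (`labelD_trivial_eq_top`) and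
  `HT_τ(ρ) = {0, …, 0}` with multiplicity `dim_E M` (`labelledHodgeTateWeights_trivial_of_forall_eq`;
  e.g. `{0, 0, 0}` for the trivial representation on `Fin 3 → ℚ`, checked as an `example` in the
  author's scratch file).

## Conventions and design choices

* **Sign.** `i` occurs with multiplicity `dim_E gr^i D_τ = dim Fil^i D_τ - dim Fil^{i+1} D_τ`, as
  for the unlabelled `PeriodRingData.hodgeTateWeights`; with `𝔅 = B_dR` (`Fil^i = t^i B_dR^+`) the
  cyclotomic character has `HT_τ = {-1}` for every `τ` (Barnet-Lamb–Gee–Geraghty–Taylor; Buzzard–Gee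
  §2.4 "the cyclotomic character gives rise to the identity `GL_1 → GL_1`").
* **`E`-linearity by type.** `ρ : ContinuousRep Γ E M` with `[Module P M] [IsScalarTower P E M]`:
  Fontaine's functor is `P`-linear but `D` is an `F ⊗_P E`-module only because `ρ` commutes with
  `E`, so the coefficient structure is part of the type; the `P`-linear representation of
  `PAdicHodge` is `ρ.restrictScalars P` (for framed `rE` over `E ⊆ ℚ̄_ℓ` this is
  `Literature.NumberTheory.Automorphic.restrictScalarsQl E rE`, definitionally).
* **No splitting field, no projector.** Patrikis extends scalars to `E'` splitting `F` and applies
  the idempotent `e_τ`; for `τ` landing in `E` itself the `τ`-eigenspace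
  `{x | (f ⊗ 1) x = (1 ⊗ τ f) x}` *is* `e_τ (D ⊗_E E')` descended to `E` (the factor of
  `F ⊗_P E = ∏ E_i` through which `τ ⊗ id` factors is `E` itself), so no extension is needed
  and `τ` ranges over `F →+* E` (a bare ring homomorphism: the `ℚ_ℓ`-algebra structure of a
  completion `K_v` is datum-supplied in this tree, and continuous embeddings of `p`-adic fields
  are automatically `ℚ_p`-linear; for a `τ` *not* compatible with `P` one gets `labelD = 0` and
  `HT_τ = 0`).
* **`E = ℚ̄_ℓ` is allowed.**  `D_τ` and `dim_E` make sense for any coefficient field, and for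
  `V = V_E ⊗_E ℚ̄_ℓ` one has `D(V) = D(V_E) ⊗_E ℚ̄_ℓ` (invariants commute with the free
  extension of scalars), so `HT_τ` may be computed directly over `ℚ̄_ℓ` as in Patrikis §2.7.1;
  only the *unlabelled* count `dim_F D = dim_P V` (`IsAdmissible`) needs `[E : P] < ∞`.
  Accordingly the global wrapper takes `ρ : FramedGaloisRep K (PadicAlgCl ℓ) n` and no model.
* **Relation to the unlabelled multiset.** If `E` contains the `[F : P]` embeddings of `F` then
  `D = ⊕_τ D_τ` and `dim_F gr^i D = [E : τF] · ∑_τ dim_E gr^i D_τ`, i.e.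
  `𝔅.hodgeTateWeights (ρ.restrictScalars P) = [E : τF] • ∑_τ HT_τ(ρ)` (multiplicities scaled
  by `[E : τF]`, which is `[E : P] / [F : P]`); in particular the unlabelled multiset of an
  `E`-linear `ρ` repeats each labelled weight `[E : τF]` times.  Not proved here.

## What is NOT here (follow-ups, all theorems — no named facts are introduced)

* `card HT_τ(ρ) = n` for de Rham `ρ` of `E`-rank `n` (needs: admissible ⇒ `D` free of rank `n`
  over `F ⊗_P E`, from Fontaine's comparison isomorphism, Astérisque 223, Exp. III, Thm. 1.5.2);
  the file proves the reduction `card_labelledHodgeTateWeights` to `dim_E D_τ = n` plus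
  finiteness of the filtration on `D_τ`.
* Invariance under finite restriction `HT_{τ'}(ρ|_{Γ_{F'}}) = HT_{τ'|_F}(ρ)` (Patrikis §2.7.1),
  behaviour under twists and direct sums, independence of the model `E`.
* For a number field `K` and `τ : K →+* ℚ̄_ℓ`: the place `v_τ ∣ ℓ` induced by `τ` and the
  continuous extension `τ_v : K_v →+* ℚ̄_ℓ` (so that `Hom(K, ℚ̄_ℓ) = ⊔_{v ∣ ℓ} Hom_cont(K_v, ℚ̄_ℓ)`);
  the global wrapper is indexed by the pair `(v, τ_v)` and a consumer holding `τ : K →+* ℚ̄_ℓ`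
  phrases the label as `τ_v.comp (algebraMap K K_v) = τ ∧ Continuous τ_v`.
* Hodge–Tate–Sen weights of non-Hodge–Tate representations (Sen operator).

## References

* S. Patrikis, *Variations on a theorem of Tate*, Mem. AMS 258 (2019), no. 1238
  (arXiv:1207.6724), §2.3.1 (Coefficients in Hodge theory: `HT_τ(D)`, Lemma on the
  `Gal(E'/E)`-orbit, Definition of *regular*), §2.7.1 (labeled Hodge–Tate(–Sen) weights).
  [Patrikis2019]
* T. Barnet-Lamb, T. Gee, D. Geraghty, R. Taylor, *Potential automorphy and change of weight*,
  Ann. of Math. 179 (2014), Introduction, Notation (`HT_τ`, `HT_τ(ε_l) = {-1}`). [BarnetlambEtAl2014]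
* K. Buzzard, T. Gee, *The conjectural connections between automorphic representations and
  Galois representations* (2014), §2.4 (Hodge–Tate cocharacter attached to `j : k → ℚ̄_p`, sign
  convention). [BuzzardGeeLMS2014]
* J.-M. Fontaine, *Représentations `p`-adiques semi-stables*, Astérisque 223 (1994), Exposé III,
  §1.5 (`D_B`, `Fil^i D`). [FontaineAsterisque223III]
-/

noncomputable section

open scoped NumberField TensorProduct
open Field IsDedekindDomain TensorProduct

namespace Literature.NumberTheory.GaloisRepresentations

universe u v v' w

/-! ### The multiset of jumps of a dimension function -/

section Jumps

open scoped Classical in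
/-- The **multiset of jumps** of `d : ℤ → ℕ` (think `d i = dim Fil^i` for a decreasing
filtration): the integer `i` occurs with multiplicity `d i - d (i + 1)` (natural-number
subtraction: non-jumps contribute nothing).  **Junk value:** `0` if the set of jumps
`{i | d (i + 1) < d i}` is infinite.  This is the recipe of `PeriodRingData.hodgeTateWeights`
(Hodge–Tate weights = jumps of the Hodge filtration, with multiplicity `dim gr^i`), isolated so
that labelled and unlabelled weights share one API. [folklore] -/
def jumpMultiset (d : ℤ → ℕ) : Multiset ℤ :=
  if h : {i : ℤ | d (i + 1) < d i}.Finite then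
    ∑ i ∈ h.toFinset, Multiset.replicate (d i - d (i + 1)) i
  else 0

open scoped Classical in
/-- Unfolding lemma for `jumpMultiset` when the set of jumps is finite. [folklore] -/
lemma jumpMultiset_of_finite {d : ℤ → ℕ} (h : {i : ℤ | d (i + 1) < d i}.Finite) :
    jumpMultiset d = ∑ i ∈ h.toFinset, Multiset.replicate (d i - d (i + 1)) i :=
  dif_pos h

/-- Unfolding lemma for `jumpMultiset` when the set of jumps is infinite (junk value `0`).
[folklore] -/
lemma jumpMultiset_of_not_finite {d : ℤ → ℕ} (h : ¬ {i : ℤ | d (i + 1) < d i}.Finite) :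
    jumpMultiset d = 0 :=
  dif_neg h

/-- The members of `jumpMultiset d` are exactly the jumps of `d`. [folklore] -/
lemma mem_jumpMultiset_iff {d : ℤ → ℕ} (h : {i : ℤ | d (i + 1) < d i}.Finite) (i : ℤ) :
    i ∈ jumpMultiset d ↔ d (i + 1) < d i := by
  rw [jumpMultiset_of_finite h, Multiset.mem_sum]
  constructor
  · rintro ⟨j, hj, hij⟩
    obtain ⟨-, rfl⟩ := Multiset.mem_replicate.1 hij
    exact h.mem_toFinset.1 hj
  · intro hi
    exact ⟨i, h.mem_toFinset.2 hi, Multiset.mem_replicate.2 ⟨(Nat.sub_pos_of_lt hi).ne', rfl⟩⟩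

/-- The multiplicity of `i` in `jumpMultiset d` is `d i - d (i + 1)`. [folklore] -/
lemma count_jumpMultiset {d : ℤ → ℕ} (h : {i : ℤ | d (i + 1) < d i}.Finite) (i : ℤ) :
    (jumpMultiset d).count i = d i - d (i + 1) := by
  classical
  rw [jumpMultiset_of_finite h, Multiset.count_sum']
  by_cases hi : d (i + 1) < d i
  · rw [Finset.sum_eq_single_of_mem i (h.mem_toFinset.2 hi)]
    · exact Multiset.count_replicate_self i _
    · intro j _ hji
      rw [Multiset.count_replicate, if_neg hji]
  · rw [Nat.sub_eq_zero_of_le (not_lt.1 hi)]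
    refine Finset.sum_eq_zero fun j hj => ?_
    rw [Multiset.count_replicate]
    split_ifs with hji
    · exact absurd (hji ▸ h.mem_toFinset.1 hj) hi
    · rfl

/-- **Telescoping.** If `d` is antitone, constant on `(-∞, a]` and on `[b, +∞)` (`a ≤ b`), then
`jumpMultiset d` has `d a - d b` elements (for `dim Fil^•` of an exhaustive separated filtration
on a finite-dimensional space: `card = dim`). [folklore] -/
lemma card_jumpMultiset {d : ℤ → ℕ} (hd : Antitone d) {a b : ℤ} (hab : a ≤ b)
    (ha : ∀ i ≤ a, d i = d a) (hb : ∀ i, b ≤ i → d i = d b) :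
    Multiset.card (jumpMultiset d) = d a - d b := by
  have hsub : {i : ℤ | d (i + 1) < d i} ⊆ Finset.Ico a b := by
    intro i hi
    simp only [Finset.coe_Ico, Set.mem_Ico]
    simp only [Set.mem_setOf_eq] at hi
    constructor
    · by_contra hlt
      rw [ha i (by omega), ha (i + 1) (by omega)] at hi
      exact lt_irrefl _ hi
    · by_contra hge
      rw [hb i (by omega), hb (i + 1) (by omega)] at hi
      exact lt_irrefl _ hi
  have hfin : {i : ℤ | d (i + 1) < d i}.Finite := (Finset.finite_toSet _).subset hsub
  rw [jumpMultiset_of_finite hfin, Multiset.card_sum]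
  simp only [Multiset.card_replicate]
  have hsub' : hfin.toFinset ⊆ Finset.Ico a b := fun i hi => hsub (hfin.mem_toFinset.1 hi)
  rw [Finset.sum_subset hsub' fun i _ hi =>
    Nat.sub_eq_zero_of_le (not_lt.1 fun hlt => hi (hfin.mem_toFinset.2 hlt))]
  -- telescoping over `Ico a b = a + range (b - a)`
  have key : ∀ n : ℕ, ∑ k ∈ Finset.range n, (d (a + k) - d (a + k + 1)) = d a - d (a + n) := by
    intro n
    induction n with
    | zero => simp
    | succ n ih =>
      rw [Finset.sum_range_succ, ih]
      have h1 : d (a + n) ≤ d a := hd (by omega)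
      have h2 : d (a + n + 1) ≤ d (a + n) := hd (by omega)
      have h3 : (a + ((n + 1 : ℕ) : ℤ)) = a + n + 1 := by push_cast; ring
      rw [h3]
      omega
  rw [Int.Ico_eq_finset_map, Finset.sum_map]
  simp only [Function.Embedding.trans_apply, Nat.castEmbedding_apply, addLeftEmbedding_apply]
  have hb' : a + ((b - a).toNat : ℤ) = b := by omega
  rw [key, hb']

/-- A dimension function with a single jump, at `w`, from `n` to `0`, has jump multiset
`{w, …, w}` (`n` times). [folklore] -/
lemma jumpMultiset_step (n : ℕ) (w : ℤ) :
    jumpMultiset (fun i => if i ≤ w then n else 0) = Multiset.replicate n w := by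
  classical
  set d : ℤ → ℕ := fun i => if i ≤ w then n else 0 with hd
  have hval : ∀ i, d i - d (i + 1) = if i = w then n else 0 := by
    intro i
    simp only [hd]
    by_cases h1 : i + 1 ≤ w
    · rw [if_pos h1, if_pos (show i ≤ w by omega), if_neg (show ¬ i = w by omega), Nat.sub_self]
    · by_cases h2 : i ≤ w
      · rw [if_neg h1, if_pos h2, if_pos (show i = w by omega), Nat.sub_zero]
      · rw [if_neg h1, if_neg h2, if_neg (show ¬ i = w by omega)]
  have hfin : {i : ℤ | d (i + 1) < d i}.Finite := by
    refine (Set.finite_singleton w).subset fun i hi => ?_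
    simp only [Set.mem_setOf_eq] at hi
    rw [Set.mem_singleton_iff]
    have := hval i
    by_contra hiw
    rw [if_neg hiw] at this
    omega
  refine Multiset.ext' fun i => ?_
  rw [count_jumpMultiset hfin, hval, Multiset.count_replicate]
  by_cases hiw : i = w
  · subst hiw; simp
  · rw [if_neg hiw, if_neg (Ne.symm hiw)]

end Jumps

/-! ### Restriction of scalars of a continuous representation -/

namespace ContinuousRep

variable {G : Type*} [Group G] [TopologicalSpace G] (P : Type*) [CommRing P] [TopologicalSpace P]
  {A : Type*} [CommRing A] [TopologicalSpace A] [Algebra P A]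
  {M : Type*} [AddCommGroup M] [Module A M] [Module P M] [IsScalarTower P A M]
  [TopologicalSpace M]

/-- **Restriction of scalars** of a continuous `A`-linear representation to a subring of
coefficients `P → A` (same maps, same topology; Mathlib `LinearMap.restrictScalars`).  Fontaine's
period-ring formalism (`PeriodRingData.D`) is `ℚ_p`-linear, whence this operation
(Buzzard–Gee 2014, §2.2; the framed special case is
`Literature.NumberTheory.Automorphic.restrictScalarsQl`). [folklore] -/
def restrictScalars (ρ : ContinuousRep G A M) : ContinuousRep G P M where
  toRepresentation :=
    { toFun := fun g => (ρ g).restrictScalars P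
      map_one' := LinearMap.ext fun x => by simp
      map_mul' := fun g h => LinearMap.ext fun x => by simp }
  continuous_smul := ρ.continuous_smul

/-- Unfolding lemma for `restrictScalars`. [folklore] -/
@[simp] lemma restrictScalars_apply (ρ : ContinuousRep G A M) (g : G) (x : M) :
    ρ.restrictScalars P g x = ρ g x := rfl

end ContinuousRep

namespace PeriodRingData

/-! ### The unlabelled weights are a jump multiset -/

section Unlabelled

variable {Γ : Type u} [Group Γ] [TopologicalSpace Γ] {P : Type v} {E : Type v'} [Field P]
  [TopologicalSpace P] [Field E] [Algebra P E]
  {M : Type*} [AddCommGroup M] [Module P M] [TopologicalSpace M]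
  (𝔅 : PeriodRingData.{u, v, v', w} Γ P E) (ρ : ContinuousRep Γ P M)

/-- `PeriodRingData.hodgeTateWeights` is the jump multiset of `i ↦ dim_E Fil^i D`
(definitionally). [folklore] -/
lemma hodgeTateWeights_eq_jumpMultiset :
    𝔅.hodgeTateWeights ρ = jumpMultiset fun i => Module.finrank E (𝔅.filD ρ i) := rfl

end Unlabelled

/-! ### `D` with coefficients: the `F ⊗_P E`-module `(M ⊗_P B)^Γ` -/

section Coeff

variable {Γ : Type u} [Group Γ] {P : Type v} {F : Type v'} [Field P] [Field F] [Algebra P F]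
  (E : Type*) [Field E] [Algebra P E]
  (M : Type*) [AddCommGroup M] [Module E M] [Module P M] [IsScalarTower P E M]
  (𝔅 : PeriodRingData.{u, v, v', w} Γ P F)

/-- The action of `f ∈ F = B^Γ` on `M ⊗_P B` through the right factor, `id ⊗ (f • ·)`, as an
`E`-linear map (`E` acting through the left factor `M`): the `F`-structure of the
`F ⊗_P E`-module `M ⊗_P B`.  Ref: Patrikis 2019, §2.3.1 (filtered `F ⊗_k E`-modules). [folklore] -/
def baseAct (f : F) : M ⊗[P] 𝔅.B →ₗ[E] M ⊗[P] 𝔅.B :=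
  AlgebraTensorModule.map LinearMap.id (Module.toModuleEnd P 𝔅.B f)

/-- Unfolding lemma for `baseAct` on pure tensors. [folklore] -/
@[simp] lemma baseAct_tmul (f : F) (m : M) (b : 𝔅.B) :
    𝔅.baseAct E M f (m ⊗ₜ[P] b) = m ⊗ₜ[P] (f • b) := rfl

/-- `M ⊗ Fil^i B ⊆ M ⊗_P B` (the image of `M ⊗_P Fil^i B`), an `E`-submodule; the analogue with
coefficients of `PeriodRingData.filTensor`.  Ref: Fontaine, Astérisque 223 (1994), Exposé III
§1.5.4. [folklore] -/
def coeffFilTensor (i : ℤ) : Submodule E (M ⊗[P] 𝔅.B) :=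
  LinearMap.range
    (AlgebraTensorModule.map (LinearMap.id : M →ₗ[E] M) ((𝔅.fil i).restrictScalars P).subtype)

/-- `M ⊗ Fil^• B` is decreasing. [folklore] -/
lemma coeffFilTensor_antitone : Antitone (𝔅.coeffFilTensor E M) := by
  intro i j hij
  rintro x ⟨y, rfl⟩
  refine ⟨AlgebraTensorModule.map (LinearMap.id : M →ₗ[E] M)
    (Submodule.inclusion (show (𝔅.fil j).restrictScalars P ≤ (𝔅.fil i).restrictScalars P from
      fun b hb => 𝔅.fil_antitone hij hb)) y, ?_⟩
  rw [← LinearMap.comp_apply, ← AlgebraTensorModule.map_comp]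
  rfl

/-- If `Fil^i B = B` then `M ⊗ Fil^i B = M ⊗_P B`. [folklore] -/
lemma coeffFilTensor_eq_top {i : ℤ} (h : 𝔅.fil i = ⊤) : 𝔅.coeffFilTensor E M i = ⊤ := by
  refine Submodule.eq_top_iff'.2 fun x => ?_
  induction x using TensorProduct.induction_on with
  | zero => exact zero_mem _
  | tmul m b =>
    exact ⟨m ⊗ₜ ⟨b, show b ∈ 𝔅.fil i by rw [h]; trivial⟩, rfl⟩
  | add x y hx hy => exact add_mem hx hy

/-- If `Fil^i B = 0` then `M ⊗ Fil^i B = 0`. [folklore] -/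
lemma coeffFilTensor_eq_bot {i : ℤ} (h : 𝔅.fil i = ⊥) : 𝔅.coeffFilTensor E M i = ⊥ := by
  refine (Submodule.eq_bot_iff _).2 ?_
  rintro x ⟨y, rfl⟩
  induction y using TensorProduct.induction_on with
  | zero => simp
  | tmul m b =>
    have hb : (b : 𝔅.B) = 0 := by
      have hb' : (b : 𝔅.B) ∈ (⊥ : Submodule F 𝔅.B) := by rw [← h]; exact b.2
      exact (Submodule.mem_bot F).1 hb'
    simp [hb]
  | add x y hx hy => rw [map_add, hx, hy, add_zero]

end Coeff

section Labelled

variable {Γ : Type u} [Group Γ] [TopologicalSpace Γ] {P : Type v} {F : Type v'} [Field P]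
  [Field F] [Algebra P F]
  {E : Type*} [Field E] [Algebra P E] [TopologicalSpace E]
  {M : Type*} [AddCommGroup M] [Module E M] [Module P M] [IsScalarTower P E M]
  [TopologicalSpace M]
  (𝔅 : PeriodRingData.{u, v, v', w} Γ P F) (ρ : ContinuousRep Γ E M)

/-- The diagonal representation `σ ↦ ρ(σ) ⊗ σ` of `Γ` on `M ⊗_P B`, **`E`-linear** (`E` acting on
`M`; the map is `TensorProduct.AlgebraTensorModule.map (ρ σ) (σ • ·)`).  Only the underlying
representation of `ρ` is used.  This is `PeriodRingData.tensorRep` of `ρ.restrictScalars P`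
transported along `TensorProduct.comm` (`comm_coeffTensorRep`), with the coefficient structure
made visible.  Ref: Fontaine, Astérisque 223 (1994), Exposé III §1.3; Patrikis 2019, §2.7.1.
[folklore] -/
def coeffTensorRep : Representation E Γ (M ⊗[P] 𝔅.B) where
  toFun σ := AlgebraTensorModule.map (ρ σ) (DistribMulAction.toModuleEnd P 𝔅.B σ)
  map_one' := by
    rw [map_one, map_one]
    exact AlgebraTensorModule.map_one
  map_mul' σ τ := by
    rw [map_mul, map_mul]
    exact AlgebraTensorModule.map_mul _ _ _ _

/-- Unfolding lemma for `coeffTensorRep` on pure tensors: `σ • (m ⊗ b) = ρ(σ) m ⊗ σ b`.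
[folklore] -/
@[simp] lemma coeffTensorRep_apply_tmul (σ : Γ) (m : M) (b : 𝔅.B) :
    𝔅.coeffTensorRep ρ σ (m ⊗ₜ[P] b) = ρ σ m ⊗ₜ[P] (σ • b) := rfl

/-- **`D(ρ) = (M ⊗_P B)^Γ` with its coefficient structure**: the `E`-submodule of invariants of
the diagonal action (Mathlib `Representation.invariants`); it is moreover stable under `F`
(`baseAct_mem_coeffD`), i.e. an `F ⊗_P E`-module.  Ref: Fontaine, Astérisque 223 (1994),
Exposé III §1.5; Patrikis 2019, §2.7.1 (`D_dR(V)` is a `K ⊗_{ℚ_ℓ} ℚ̄_ℓ`-module). [folklore] -/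
def coeffD : Submodule E (M ⊗[P] 𝔅.B) :=
  (𝔅.coeffTensorRep ρ).invariants

/-- Membership in `coeffD`: invariance under every `σ`. [folklore] -/
lemma mem_coeffD_iff (x : M ⊗[P] 𝔅.B) :
    x ∈ 𝔅.coeffD ρ ↔ ∀ σ : Γ, 𝔅.coeffTensorRep ρ σ x = x := Iff.rfl

/-- The `F`-action commutes with the diagonal `Γ`-action (the action of `Γ` on `B` is
`F`-linear, `PeriodRingData.smulComm`). [folklore] -/
lemma baseAct_comm (f : F) (σ : Γ) (x : M ⊗[P] 𝔅.B) :
    𝔅.baseAct E M f (𝔅.coeffTensorRep ρ σ x) = 𝔅.coeffTensorRep ρ σ (𝔅.baseAct E M f x) := by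
  induction x using TensorProduct.induction_on with
  | zero => simp
  | tmul m b => simp [smul_comm σ f b]
  | add x y hx hy => simp [hx, hy]

/-- `D(ρ)` is stable under `F`. [folklore] -/
lemma baseAct_mem_coeffD (f : F) {x : M ⊗[P] 𝔅.B} (hx : x ∈ 𝔅.coeffD ρ) :
    𝔅.baseAct E M f x ∈ 𝔅.coeffD ρ :=
  fun σ => by rw [← baseAct_comm, hx σ]

/-- The **`τ`-component** `D_τ = e_τ D` of `D(ρ) = (M ⊗_P B)^Γ` for `τ : F →+* E`: the invariant
tensors on which every `f ∈ F` (acting through `B`) acts as the scalar `τ(f) ∈ E` (acting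
through `M`).  When `E` contains the `[F : P]` embeddings of `F`, `F ⊗_P E ≅ ∏_τ E` and
`D = ⊕_τ D_τ`; for `F/P` finite separable `F ⊗_P E` is a finite product of fields and `D_τ` is
the factor of `D` through which `τ ⊗ id : F ⊗_P E → E` factors, i.e. Patrikis's
`e_τ(D ⊗_E E')` descended to `E`.  Ref: Patrikis 2019, §2.3.1;
Barnet-Lamb–Gee–Geraghty–Taylor 2014, Notation (`W ⊗_{τ,K} -`).
[cite: Patrikis2019, §2.3.1] -/
def labelD (τ : F →+* E) : Submodule E (M ⊗[P] 𝔅.B) where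
  carrier := {x | x ∈ 𝔅.coeffD ρ ∧ ∀ f : F, 𝔅.baseAct E M f x = τ f • x}
  add_mem' := by
    rintro x y ⟨hx, hx'⟩ ⟨hy, hy'⟩
    exact ⟨add_mem hx hy, fun f => by rw [map_add, hx', hy', smul_add]⟩
  zero_mem' := ⟨zero_mem _, fun f => by rw [map_zero, smul_zero]⟩
  smul_mem' := by
    rintro c x ⟨hx, hx'⟩
    exact ⟨Submodule.smul_mem _ c hx, fun f => by rw [map_smul, hx', smul_comm]⟩

/-- Membership in the `τ`-component. [folklore] -/
lemma mem_labelD_iff (τ : F →+* E) (x : M ⊗[P] 𝔅.B) :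
    x ∈ 𝔅.labelD ρ τ ↔ x ∈ 𝔅.coeffD ρ ∧ ∀ f : F, 𝔅.baseAct E M f x = τ f • x := Iff.rfl

/-- `D_τ ≤ D`. [folklore] -/
lemma labelD_le_coeffD (τ : F →+* E) : 𝔅.labelD ρ τ ≤ 𝔅.coeffD ρ := fun _ hx => hx.1

/-- The induced filtration **`Fil^i D_τ = D_τ ∩ (M ⊗ Fil^i B)`** on the `τ`-component (for
`𝔅 = B_dR`: the Hodge filtration of `D_dR(ρ) ⊗_{F ⊗ E, τ ⊗ 1} E`).  Ref: Fontaine, Astérisque 223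
(1994), Exposé III §1.5.4; Patrikis 2019, §2.3.1. [folklore] -/
def labelFilD (τ : F →+* E) (i : ℤ) : Submodule E (M ⊗[P] 𝔅.B) :=
  𝔅.labelD ρ τ ⊓ 𝔅.coeffFilTensor E M i

/-- `Fil^• D_τ` is decreasing. [folklore] -/
lemma labelFilD_antitone (τ : F →+* E) : Antitone (𝔅.labelFilD ρ τ) :=
  fun _ _ hij => inf_le_inf_left _ (𝔅.coeffFilTensor_antitone E M hij)

/-- `Fil^i D_τ ≤ D_τ`. [folklore] -/
lemma labelFilD_le (τ : F →+* E) (i : ℤ) : 𝔅.labelFilD ρ τ i ≤ 𝔅.labelD ρ τ := inf_le_left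

/-- The **`τ`-labelled Hodge–Tate weights `HT_τ(ρ)`** of the `E`-linear representation `ρ`
relative to the period-ring datum `𝔅` (intended: `B_dR(F)`, or `B_HT(F)`) and the embedding
`τ : F →+* E`: the integer `i` occurs with multiplicity
`dim_E Fil^i D_τ - dim_E Fil^{i+1} D_τ = dim_E gr^i D_τ` (`jumpMultiset`; junk value `0` if the
set of jumps is infinite, impossible for finite-dimensional `D_τ`).  Convention: with `B_dR` and
`Fil^i = t^i B_dR^+` the cyclotomic character has `HT_τ = {-1}` at every `τ`.  Patrikis: `HT_τ(D)`
is the collection of `h` with `gr^h(e_τ D) ≠ 0`, with multiplicity, and `HT_τ(V) := HT_τ(D_dR V)`;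
Barnet-Lamb–Gee–Geraghty–Taylor: `HT_τ(W)` contains `i` with multiplicity
`dim (W ⊗_{τ,K} K̂̄(i))^{G_K}`.
[cite: Patrikis2019, §2.3.1 and §2.7.1] [cite: BarnetlambEtAl2014, Introduction (Notation)] -/
def labelledHodgeTateWeights (τ : F →+* E) : Multiset ℤ :=
  jumpMultiset fun i => Module.finrank E (𝔅.labelFilD ρ τ i)

/-- Unfolding lemma for `labelledHodgeTateWeights`. [folklore] -/
lemma labelledHodgeTateWeights_def (τ : F →+* E) :
    𝔅.labelledHodgeTateWeights ρ τ = jumpMultiset fun i => Module.finrank E (𝔅.labelFilD ρ τ i) :=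
  rfl

/-- `ρ` is **Hodge–Tate regular with respect to the labelled weights**: for every `P`-algebra
embedding `τ : F →ₐ[P] E` the multiset `HT_τ(ρ)` is multiplicity-free (Patrikis, Definition
"regular" of §2.3.1; Barnet-Lamb–Gee–Geraghty–Taylor: "`n` distinct `τ`-Hodge–Tate numbers for
each `τ`").  A predicate on `(𝔅, ρ)` (explicit binders), vacuous if no embedding `F →ₐ[P] E`
exists. [cite: Patrikis2019, §2.3.1] -/
def IsLabelledHodgeTateRegular (𝔅 : PeriodRingData.{u, v, v', w} Γ P F)
    (ρ : ContinuousRep Γ E M) : Prop :=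
  ∀ τ : F →ₐ[P] E, (𝔅.labelledHodgeTateWeights ρ τ.toRingHom).Nodup

/-- `i ∈ HT_τ(ρ)` iff the filtration of `D_τ` jumps at `i` (finitely many jumps assumed).
[folklore] -/
lemma mem_labelledHodgeTateWeights_iff (τ : F →+* E)
    (h : {i : ℤ | Module.finrank E (𝔅.labelFilD ρ τ (i + 1)) <
      Module.finrank E (𝔅.labelFilD ρ τ i)}.Finite) (i : ℤ) :
    i ∈ 𝔅.labelledHodgeTateWeights ρ τ ↔
      Module.finrank E (𝔅.labelFilD ρ τ (i + 1)) < Module.finrank E (𝔅.labelFilD ρ τ i) :=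
  mem_jumpMultiset_iff h i

/-- **`card HT_τ(ρ) = dim_E D_τ`** as soon as the filtration of the finite-dimensional `D_τ` is
exhausted at some `a` (`Fil^a D_τ = D_τ`) and separated at some `b` (`Fil^b D_τ = 0`).  (For a
de Rham `ρ` of `E`-rank `n`, `dim_E D_τ = n`; that freeness statement is not proved in this
file.) [folklore] -/
theorem card_labelledHodgeTateWeights (τ : F →+* E) [FiniteDimensional E (𝔅.labelD ρ τ)]
    {a b : ℤ} (ha : 𝔅.labelFilD ρ τ a = 𝔅.labelD ρ τ) (hb : 𝔅.labelFilD ρ τ b = ⊥) :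
    Multiset.card (𝔅.labelledHodgeTateWeights ρ τ) = Module.finrank E (𝔅.labelD ρ τ) := by
  haveI : ∀ i, FiniteDimensional E (𝔅.labelFilD ρ τ i) :=
    fun i => Submodule.finiteDimensional_of_le (𝔅.labelFilD_le ρ τ i)
  set d : ℤ → ℕ := fun i => Module.finrank E (𝔅.labelFilD ρ τ i) with hd
  have hanti : Antitone d :=
    fun i j hij => Submodule.finrank_mono (𝔅.labelFilD_antitone ρ τ hij)
  have hlow : ∀ i ≤ a, 𝔅.labelFilD ρ τ i = 𝔅.labelD ρ τ := fun i hi =>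
    le_antisymm (𝔅.labelFilD_le ρ τ i) (by rw [← ha]; exact 𝔅.labelFilD_antitone ρ τ hi)
  have hhigh : ∀ i, b ≤ i → 𝔅.labelFilD ρ τ i = ⊥ := fun i hi =>
    eq_bot_iff.2 (by rw [← hb]; exact 𝔅.labelFilD_antitone ρ τ hi)
  have h1 : ∀ i ≤ a, d i = d a := fun i hi => by
    simp only [hd]
    rw [hlow i hi, hlow a le_rfl]
  have h2 : ∀ i, max a b ≤ i → d i = d (max a b) := fun i hi => by
    simp only [hd]
    rw [hhigh i ((le_max_right a b).trans hi), hhigh (max a b) (le_max_right a b)]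
  rw [labelledHodgeTateWeights_def, card_jumpMultiset hanti (le_max_left a b) h1 h2]
  simp only [hd]
  rw [hlow a le_rfl, hhigh (max a b) (le_max_right a b), finrank_bot, Nat.sub_zero]

/-! ### Bridge to `PAdicHodge`: `coeffD` is `D` of the restriction of scalars -/

variable [TopologicalSpace P]

/-- `TensorProduct.comm` intertwines the `E`-linear diagonal action on `M ⊗_P B` with the
diagonal action `PeriodRingData.tensorRep` of the `P`-linear restriction of scalars on
`B ⊗_P M`. [folklore] -/
lemma comm_coeffTensorRep (σ : Γ) (x : M ⊗[P] 𝔅.B) :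
    TensorProduct.comm P M 𝔅.B (𝔅.coeffTensorRep ρ σ x) =
      𝔅.tensorRep (ρ.restrictScalars P) σ (TensorProduct.comm P M 𝔅.B x) := by
  induction x using TensorProduct.induction_on with
  | zero => simp
  | tmul m b => rfl
  | add x y hx hy => simp [hx, hy]

/-- `x ∈ coeffD 𝔅 ρ ↔ comm x ∈ D 𝔅 (ρ.restrictScalars P)`: the `D` with coefficients of this file
is Fontaine's `D_B` of `PAdicHodge` for the underlying `P`-linear representation. [folklore] -/
lemma mem_coeffD_iff_comm_mem_D (x : M ⊗[P] 𝔅.B) :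
    x ∈ 𝔅.coeffD ρ ↔ TensorProduct.comm P M 𝔅.B x ∈ 𝔅.D (ρ.restrictScalars P) := by
  simp only [mem_coeffD_iff, mem_D_iff, ← comm_coeffTensorRep]
  exact forall_congr' fun σ => (TensorProduct.comm P M 𝔅.B).injective.eq_iff.symm

end Labelled

/-! ### The base datum: all labelled weights are `0` -/

section Trivial

variable {Γ : Type u} [Group Γ] [TopologicalSpace Γ] {P : Type v} {F : Type v'} [Field P]
  [Field F] [Algebra P F]
  {E : Type*} [Field E] [Algebra P E] [TopologicalSpace E]
  {M : Type*} [AddCommGroup M] [Module E M] [Module P M] [IsScalarTower P E M]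
  [TopologicalSpace M]
  (ρ : ContinuousRep Γ E M) (τ : F →+* E)

/-- For the **base datum `B = F`** (`PeriodRingData.trivial`: trivial `Γ`-action, trivial
filtration `Fil^i = F` for `i ≤ 0`, `0` for `i > 0`) every labelled Hodge–Tate weight is `0`:
`HT_τ(ρ) = {0, …, 0}` with multiplicity `dim_E D_τ` (which is `0`, by convention of
`Module.finrank`, if `D_τ` is infinite-dimensional). [folklore] -/
theorem labelledHodgeTateWeights_trivial :
    (trivial Γ P F).labelledHodgeTateWeights ρ τ =
      Multiset.replicate (Module.finrank E ((trivial Γ P F).labelD ρ τ)) 0 := by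
  rw [labelledHodgeTateWeights_def, ← jumpMultiset_step]
  congr 1
  funext i
  by_cases hi : i ≤ 0
  · rw [if_pos hi, labelFilD, coeffFilTensor_eq_top, inf_top_eq]
    rw [trivial_fil]
    exact trivialFil_of_nonpos F hi
  · rw [if_neg hi, labelFilD, coeffFilTensor_eq_bot, inf_bot_eq, finrank_bot]
    rw [trivial_fil]
    exact trivialFil_of_pos F (not_le.1 hi)

end Trivial

/-! ### The base datum over the prime field: `HT_τ` of a trivial representation -/

section TrivialPrime

variable {Γ : Type u} [Group Γ] [TopologicalSpace Γ] {P : Type v} [Field P]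
  {E : Type*} [Field E] [Algebra P E] [TopologicalSpace E]
  {M : Type*} [AddCommGroup M] [Module E M] [Module P M] [IsScalarTower P E M]
  [TopologicalSpace M]
  (ρ : ContinuousRep Γ E M)

/-- For the base datum over the prime field (`F = P`, `B = P`, trivial action and filtration),
a representation on which `Γ` acts trivially and the structure embedding `τ = algebraMap P E`:
the `τ`-component is everything, `D_τ = M ⊗_P P`. [folklore] -/
theorem labelD_trivial_eq_top (h : ∀ (σ : Γ) (v : M), ρ σ v = v) :
    (trivial Γ P P).labelD ρ (algebraMap P E) = ⊤ := by
  refine Submodule.eq_top_iff'.2 fun x => ⟨fun σ => ?_, fun f => ?_⟩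
  · induction x using TensorProduct.induction_on with
    | zero => simp
    | tmul m b => rw [coeffTensorRep_apply_tmul, h, trivial_smul]
    | add x y hx hy => simp only [map_add, hx, hy]
  · induction x using TensorProduct.induction_on with
    | zero => simp
    | tmul m b =>
      rw [baseAct_tmul, algebraMap_smul, TensorProduct.smul_tmul', TensorProduct.smul_tmul]
      rfl
    | add x y hx hy => simp only [map_add, smul_add, hx, hy]

/-- … hence `HT_τ(ρ) = {0, …, 0}` with multiplicity `dim_E M` (non-vacuity of the definition:
e.g. the trivial rank-`n` representation has `n` labelled weights `0`). [folklore] -/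
theorem labelledHodgeTateWeights_trivial_of_forall_eq (h : ∀ (σ : Γ) (v : M), ρ σ v = v) :
    (trivial Γ P P).labelledHodgeTateWeights ρ (algebraMap P E) =
      Multiset.replicate (Module.finrank E M) 0 := by
  rw [labelledHodgeTateWeights_trivial, labelD_trivial_eq_top ρ h, finrank_top]
  congr 1
  exact (AlgebraTensorModule.rid P E M : M ⊗[P] (trivial Γ P P).B ≃ₗ[E] M).finrank_eq

end TrivialPrime

end PeriodRingData

/-! ### Galois representations: local aliases and the global wrapper -/

namespace GaloisRep

variable {P : Type v} {F : Type v'} [Field P] [Field F] [Algebra P F]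
  {E : Type*} [Field E] [Algebra P E] [TopologicalSpace E]
  {M : Type*} [AddCommGroup M] [Module E M] [Module P M] [IsScalarTower P E M]
  [TopologicalSpace M]

/-- **`HT_τ(ρ)`** for an `E`-linear representation `ρ : Γ_F → GL(M)` of the absolute Galois group
of the `p`-adic field `F`, relative to the period-ring datum `𝔅` (intended `B_dR(F)`) and
`τ : F →+* E` (alias of `PeriodRingData.labelledHodgeTateWeights` for `Γ = Γ_F`).
[cite: Patrikis2019, §2.7.1] -/
abbrev labelledHodgeTateWeights
    (𝔅 : PeriodRingData.{v', v, v', w} (absoluteGaloisGroup F) P F) (ρ : GaloisRep F E M)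
    (τ : F →+* E) : Multiset ℤ :=
  𝔅.labelledHodgeTateWeights ρ τ

/-- `ρ : Γ_F → GL(M)` is **Hodge–Tate regular** (labelled form): every `HT_τ(ρ)`,
`τ : F →ₐ[P] E`, is multiplicity-free (alias of `PeriodRingData.IsLabelledHodgeTateRegular`).
[cite: Patrikis2019, §2.3.1] -/
abbrev IsLabelledHodgeTateRegular
    (𝔅 : PeriodRingData.{v', v, v', w} (absoluteGaloisGroup F) P F) (ρ : GaloisRep F E M) :
    Prop :=
  𝔅.IsLabelledHodgeTateRegular ρ

end GaloisRep

namespace FramedGaloisRep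

variable {K : Type u} [Field K] [NumberField K] {ℓ : ℕ} [Fact ℓ.Prime] {n : ℕ}

/-- **Global wrapper**: the `τ`-labelled Hodge–Tate weights of `ρ : Γ_K →ₜ* GL_n(ℚ̄_ℓ)` (`K` a
number field) **at the finite place `v`**, for a `ℚ_ℓ`-algebra structure `alg` on `K_v`, a
period-ring datum `𝔅` for `Γ_{K_v}` over `ℚ_ℓ` with invariants `K_v` (intended: `B_dR(K_v)`;
in the summit statement these are the fields `algebra`, `𝔅` of the reciprocity datum's
`PstWeilDeligneData K_v ℓ` at `v ∣ ℓ`) and an embedding `τ : K_v →+* ℚ̄_ℓ` (intended: continuous):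
`HT_τ(ρ|_{Γ_{K_v}})`, computed `ℚ̄_ℓ`-linearly on `ℚ̄_ℓ^n ⊗_{ℚ_ℓ} B` (no `ℚ_ℓ`-model of `ρ` is
needed, see the module docstring).  Labels `τ : K →+* ℚ̄_ℓ` of the literature correspond to
pairs `(v, τ_v)` with `τ_v` continuous and `τ_v ∘ (K → K_v) = τ`.
[cite: Patrikis2019, §2.7.1] [cite: BarnetlambEtAl2014, Introduction (Notation)] -/
def labelledHodgeTateWeightsAt (ρ : FramedGaloisRep K (PadicAlgCl ℓ) n)
    (v : HeightOneSpectrum (𝓞 K)) (alg : Algebra ℚ_[ℓ] (v.adicCompletion K))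
    (𝔅 : PeriodRingData.{u, 0, u, w} (absoluteGaloisGroup (v.adicCompletion K)) ℚ_[ℓ]
      (v.adicCompletion K))
    (τ : v.adicCompletion K →+* PadicAlgCl ℓ) : Multiset ℤ :=
  letI := alg
  𝔅.labelledHodgeTateWeights (ρ.toLocal v).toGaloisRep τ

/-- Unfolding lemma for `labelledHodgeTateWeightsAt`. [folklore] -/
lemma labelledHodgeTateWeightsAt_def (ρ : FramedGaloisRep K (PadicAlgCl ℓ) n)
    (v : HeightOneSpectrum (𝓞 K)) (alg : Algebra ℚ_[ℓ] (v.adicCompletion K))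
    (𝔅 : PeriodRingData.{u, 0, u, w} (absoluteGaloisGroup (v.adicCompletion K)) ℚ_[ℓ]
      (v.adicCompletion K))
    (τ : v.adicCompletion K →+* PadicAlgCl ℓ) :
    ρ.labelledHodgeTateWeightsAt v alg 𝔅 τ =
      letI := alg; 𝔅.labelledHodgeTateWeights (ρ.toLocal v).toGaloisRep τ :=
  rfl

end FramedGaloisRep

end Literature.NumberTheory.GaloisRepresentations
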